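import Mathlib
import HarnessLib
import Literature.Probability.MarkovChains.SpectralRepresentation

/-!
# `4‖Pᵗ(x,·) − π‖²_TV ≤ ‖Pᵗ(x,·)/π − 1‖²₂ = Σ_{j≥2} f_j(x)²λ_j^{2t}` (Levin–Peres–Wilmer Lemma 12.18 (i)) and Theorem 12.4 as printed: `t_mix(ε) ≤ ⌈t_rel(½ log(1/π_min) + log(1/(2ε)))⌉`

HONEST FRAMING: exact (Metropolis-corrected) sampling algorithms for lattice gauge theory; figures
of merit are autocorrelation/cost numbers at stated couplings and volumes; no continuum-physics claim.

Conventions of `SpectralRepresentation.lean` (the `π`-orthonormal eigenfunctions `specFun hA j = f_j`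
with eigenvalues `specVal hA j = λ_j` of a `P` reversible with respect to `π > 0`, `hA` the
symmetry of `A = D^{1/2}PD^{−1/2}`; `kernelAt P t x y = Pᵗ(x,y)`; `lambdaStar`, `absSpectralGap = γ⋆`,
`relaxationTime = t_rel`; `worstTvDist = d(·)`, `mixingTime = t_mix(·)`), `PeskunOrdering.lean`
(`piInner π g h = ⟨g,h⟩_π`, so `‖g‖₂² = piInner π g g` is the `ℓ²(π)` norm of §4.7 / §12.6) and
`TotalVariation.lean` (`tvDist`).  Source: D. A. Levin, Y. Peres (with E. L. Wilmer), *Markov Chains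
and Mixing Times*, 2nd ed., AMS 2017 [LevinPeres2017], §4.7, §12.2, §12.6.  Everything is PROVED
(0 named facts).

* `four_mul_tvDist_sq_le_piInner` — `4‖μ − π‖²_TV ≤ ‖μ/π − 1‖²₂` for any vector `μ` and a positive
  probability vector `π` (`2‖μ − π‖_TV = ‖μ/π − 1‖₁ ≤ ‖μ/π − 1‖₂`, Proposition 4.2 and the
  monotonicity of `ℓ^p(π)` norms, eq. (4.37) `2d(t) = d^{(1)}(t) ≤ d^{(2)}(t)`)
  [cite: LevinPeres2017, §4.7 eq. (4.37); §12.6 Lemma 12.18 (i) (first inequality)];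
* `piInner_sum_mul_specFun` — Parseval for a finite combination of the `f_j`:
  `⟨Σ_J a_j f_j, Σ_J b_j f_j⟩_π = Σ_J a_j b_j` [cite: LevinPeres2017, §12.1 Lemma 12.2 (i)
  (orthonormality (12.3))];
* **LEMMA 12.18 (i)** `LevinPeres2017_lemma_12_18_i_eq` — for a reversible IRREDUCIBLE `P`,
  **`‖Pᵗ(x,·)/π(·) − 1‖²₂ = Σ_{j : λ_j ≠ 1} f_j(x)² λ_j^{2t}`** (eq. (12.26); the book's `Σ_{j ≥ 2}`
  with `f₁ = 1` is the sum over the `λ_j ≠ 1` block here, cf. `SpectralRepresentation.lean`) and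
  `LevinPeres2017_lemma_12_18_i` — **`4‖Pᵗ(x,·) − π‖²_TV ≤ Σ_{j : λ_j ≠ 1} f_j(x)² λ_j^{2t}`**
  [cite: LevinPeres2017, §12.6 Lemma 12.18 (i), eq. (12.26)];
* `two_mul_tvDist_kernelAt_le` — `2‖Pᵗ(x,·) − π‖_TV ≤ λ⋆ᵗ/√π(x)`; `worstTvDist_le_exp_div_two_sqrt` —
  **`d(t) ≤ e^{−γ⋆t}/(2√π_min)`** ("`d(t) ≤ ½√(d^{(∞)}(2t)) ≤ e^{−γ⋆t}/(2√π_min)`")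
  [cite: LevinPeres2017, §12.2 Thm 12.4 (proof, last display)];
* **THEOREM 12.4 AS PRINTED** `LevinPeres2017_thm_12_4_sharp`: for a reversible, irreducible `P`
  with `λ⋆ < 1` (positive `π`, `0 < π_min ≤ π`),
  **`t_mix(ε) ≤ ⌈t_rel(½ log(1/π_min) + log(1/(2ε)))⌉`** — the first inequality of (12.10)
  [cite: LevinPeres2017, §12.2 Thm 12.4 eq. (12.10)].  (The cruder `⌈t_rel log(1/(2επ_min))⌉` of
  `SpectralRepresentation.LevinPeres2017_thm_12_4` is the `ℓ¹` route; this file is the `ℓ²` route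
  of the printed proof, with Lemma 12.18 (i) in place of the detour through `d^{(∞)}(2t)` and
  Proposition 4.15 — the same chain of inequalities.)
-/

namespace Literature.Probability.MarkovChains

open Finset Matrix

variable {X : Type*} [Fintype X] [DecidableEq X]

/-! ## `4‖μ − π‖²_TV ≤ ‖μ/π − 1‖²₂` -/

omit [DecidableEq X] in
/-- `2‖μ − π‖_TV = ‖μ/π − 1‖_{ℓ¹(π)} ≤ ‖μ/π − 1‖_{ℓ²(π)}` (Cauchy–Schwarz against the probability
vector `π > 0`), squared: `4‖μ − π‖²_TV ≤ Σ_y π(y)(μ(y)/π(y) − 1)²`.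
[cite: LevinPeres2017, §4.7 eq. (4.37) (`2d(t) = d^{(1)}(t) ≤ d^{(2)}(t)`, Proposition 4.2 and
Exercise 4.5); §12.6 Lemma 12.18 (i)] -/
theorem four_mul_tvDist_sq_le_piInner {π : X → ℝ} (hπ : ∀ x, 0 < π x) (hπ1 : ∑ x, π x = 1)
    (μ : X → ℝ) :
    4 * tvDist μ π ^ 2 ≤ piInner π (fun y => μ y / π y - 1) (fun y => μ y / π y - 1) := by
  -- `Σ |μ − π| = Σ √π · (√π |μ/π − 1|) ≤ √(Σ π) √(Σ π (μ/π − 1)²)`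
  have hterm : ∀ y, |μ y - π y| = Real.sqrt (π y) * (Real.sqrt (π y) * |μ y / π y - 1|) := by
    intro y
    have hy : π y ≠ 0 := (hπ y).ne'
    have h1 : π y * (μ y / π y - 1) = μ y - π y := by
      rw [mul_sub, mul_one, mul_div_assoc', mul_comm (π y) (μ y), mul_div_cancel_right₀ _ hy]
    rw [← mul_assoc, Real.mul_self_sqrt (hπ y).le, ← h1, abs_mul, abs_of_pos (hπ y)]
  have hCS := Real.sum_mul_le_sqrt_mul_sqrt univ (fun y => Real.sqrt (π y))
    (fun y => Real.sqrt (π y) * |μ y / π y - 1|)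
  have hsq1 : ∑ y, Real.sqrt (π y) ^ 2 = 1 := by
    rw [← hπ1]; exact sum_congr rfl fun y _ => Real.sq_sqrt (hπ y).le
  have hsq2 : ∑ y, (Real.sqrt (π y) * |μ y / π y - 1|) ^ 2 =
      piInner π (fun y => μ y / π y - 1) (fun y => μ y / π y - 1) := by
    unfold piInner
    refine sum_congr rfl fun y _ => ?_
    rw [mul_pow, Real.sq_sqrt (hπ y).le, sq_abs, sq]
  rw [hsq1, hsq2, Real.sqrt_one, one_mul] at hCS
  have hsum : ∑ y, |μ y - π y| = ∑ y, Real.sqrt (π y) * (Real.sqrt (π y) * |μ y / π y - 1|) :=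
    sum_congr rfl fun y _ => hterm y
  have h2tv : 2 * tvDist μ π = ∑ y, |μ y - π y| := by unfold tvDist; ring
  have hI0 : 0 ≤ piInner π (fun y => μ y / π y - 1) (fun y => μ y / π y - 1) :=
    sum_nonneg fun y _ => mul_nonneg (hπ y).le (mul_self_nonneg _)
  have h0 : 0 ≤ 2 * tvDist μ π := by linarith [tvDist_nonneg μ π]
  have hle : 2 * tvDist μ π ≤
      Real.sqrt (piInner π (fun y => μ y / π y - 1) (fun y => μ y / π y - 1)) := by
    rw [h2tv, hsum]; exact hCS
  calc 4 * tvDist μ π ^ 2 = (2 * tvDist μ π) ^ 2 := by ring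
    _ ≤ Real.sqrt (piInner π (fun y => μ y / π y - 1) (fun y => μ y / π y - 1)) ^ 2 :=
        pow_le_pow_left₀ h0 hle 2
    _ = piInner π (fun y => μ y / π y - 1) (fun y => μ y / π y - 1) := Real.sq_sqrt hI0

/-! ## Parseval for finite combinations of the `f_j` and Lemma 12.18 (i) -/

section Spectral

variable {π : X → ℝ} {P : Matrix X X ℝ}

/-- `⟨Σ_{j∈J} a_j f_j, Σ_{k∈J} b_k f_k⟩_π = Σ_{j∈J} a_j b_j` by the `π`-orthonormality of the `f_j`.
[cite: LevinPeres2017, §12.1 Lemma 12.2 (i), eq. (12.3)] -/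
theorem piInner_sum_mul_specFun (hπ : ∀ x, 0 < π x) (hA : (symmMatrix π P).IsHermitian)
    (J : Finset X) (a b : X → ℝ) :
    piInner π (fun y => ∑ j ∈ J, a j * specFun hA j y) (fun y => ∑ k ∈ J, b k * specFun hA k y) =
      ∑ j ∈ J, a j * b j := by
  have horth := piInner_specFun hπ hA
  unfold piInner at horth ⊢
  -- expand the product of sums and move the `y`-sum inside
  calc ∑ y, π y * ((∑ j ∈ J, a j * specFun hA j y) * ∑ k ∈ J, b k * specFun hA k y)
      = ∑ y, ∑ j ∈ J, ∑ k ∈ J, a j * b k * (π y * (specFun hA j y * specFun hA k y)) := by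
        refine sum_congr rfl fun y _ => ?_
        rw [sum_mul_sum, mul_sum]
        refine sum_congr rfl fun j _ => ?_
        rw [mul_sum]
        exact sum_congr rfl fun k _ => by ring
    _ = ∑ j ∈ J, ∑ k ∈ J, a j * b k * ∑ y, π y * (specFun hA j y * specFun hA k y) := by
        rw [sum_comm]
        refine sum_congr rfl fun j _ => ?_
        rw [sum_comm]
        refine sum_congr rfl fun k _ => ?_
        rw [mul_sum]
    _ = ∑ j ∈ J, ∑ k ∈ J, a j * b k * (if j = k then 1 else 0) := by
        refine sum_congr rfl fun j _ => sum_congr rfl fun k _ => ?_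
        rw [horth j k]
    _ = ∑ j ∈ J, a j * b j := by
        refine sum_congr rfl fun j hj => ?_
        simp_rw [mul_ite, mul_one, mul_zero]
        rw [sum_ite_eq J j (fun k => a j * b k)]
        rw [if_pos hj]

/-- **Lemma 12.18 (i), the identity (12.26)**: for a reversible IRREDUCIBLE `P` (positive `π`),
`‖Pᵗ(x,·)/π(·) − 1‖²₂ = Σ_{j : λ_j ≠ 1} f_j(x)² λ_j^{2t}` ("By Lemma 12.2, `‖Pᵗ(x,·)/π(·) − 1‖²₂ =
‖Σ_{j≥2} λ_jᵗ f_j(x) f_j‖²₂ = Σ_{j≥2} f_j(x)²λ_j^{2t}`").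
[cite: LevinPeres2017, §12.6 Lemma 12.18 (i), eq. (12.26)] -/
theorem LevinPeres2017_lemma_12_18_i_eq (hπ : ∀ x, 0 < π x) (hπ1 : ∑ x, π x = 1)
    (hP : IsRowStochastic P) (hDB : DetailedBalance π P) (hirr : IsIrreducible P)
    (hA : (symmMatrix π P).IsHermitian) (t : ℕ) (x : X) :
    piInner π (fun y => kernelAt P t x y / π y - 1) (fun y => kernelAt P t x y / π y - 1) =
      ∑ j ∈ univ.filter (fun j => specVal hA j ≠ 1), specFun hA j x ^ 2 * specVal hA j ^ (2 * t) := by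
  set J := univ.filter (fun j => specVal hA j ≠ 1) with hJ
  -- `Pᵗ(x,y)/π(y) − 1 = Σ_J (λ_jᵗ f_j(x)) f_j(y)`
  have hexp : ∀ y, kernelAt P t x y / π y - 1 =
      ∑ j ∈ J, (specVal hA j ^ t * specFun hA j x) * specFun hA j y := by
    intro y
    have h := LevinPeres2017_eq_12_2 hπ hπ1 hP hDB hirr hA t x y
    have hy : π y ≠ 0 := (hπ y).ne'
    have h2 : kernelAt P t x y / π y - 1 = (kernelAt P t x y - π y) / π y := by field_simp
    rw [h2, h, mul_div_cancel_left₀ _ hy]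
    exact sum_congr rfl fun j _ => by ring
  have hfun : (fun y => kernelAt P t x y / π y - 1) =
      fun y => ∑ j ∈ J, (specVal hA j ^ t * specFun hA j x) * specFun hA j y := funext hexp
  rw [hfun, piInner_sum_mul_specFun hπ hA J]
  exact sum_congr rfl fun j _ => by ring

/-- **Lemma 12.18 (i)**: `4‖Pᵗ(x,·) − π‖²_TV ≤ ‖Pᵗ(x,·)/π(·) − 1‖²₂ = Σ_{j : λ_j ≠ 1} f_j(x)²λ_j^{2t}`
for a reversible irreducible `P` (positive `π`). [cite: LevinPeres2017, §12.6 Lemma 12.18 (i)] -/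
theorem LevinPeres2017_lemma_12_18_i (hπ : ∀ x, 0 < π x) (hπ1 : ∑ x, π x = 1)
    (hP : IsRowStochastic P) (hDB : DetailedBalance π P) (hirr : IsIrreducible P)
    (hA : (symmMatrix π P).IsHermitian) (t : ℕ) (x : X) :
    4 * tvDist (lawAt P (Pi.single x 1) t) π ^ 2 ≤
      ∑ j ∈ univ.filter (fun j => specVal hA j ≠ 1), specFun hA j x ^ 2 * specVal hA j ^ (2 * t) := by
  rw [← LevinPeres2017_lemma_12_18_i_eq hπ hπ1 hP hDB hirr hA t x]
  exact four_mul_tvDist_sq_le_piInner hπ hπ1 _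

/-! ## Theorem 12.4 as printed -/

/-- `Σ_{j : λ_j ≠ 1} f_j(x)² λ_j^{2t} ≤ λ⋆^{2t}/π(x)` ("this bound and (12.12)": `|λ_j| ≤ λ⋆` and
`Σ_{j≥2} f_j(x)² ≤ π(x)⁻¹`). [cite: LevinPeres2017, §12.2 Thm 12.4 (proof), eqs. (12.12)–(12.13)] -/
theorem sum_sq_specFun_mul_pow_le (hπ : ∀ x, 0 < π x) (hA : (symmMatrix π P).IsHermitian)
    (t : ℕ) (x : X) :
    ∑ j ∈ univ.filter (fun j => specVal hA j ≠ 1), specFun hA j x ^ 2 * specVal hA j ^ (2 * t) ≤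
      lambdaStar P ^ (2 * t) / π x := by
  set J := univ.filter (fun j => specVal hA j ≠ 1) with hJ
  have hl0 : 0 ≤ lambdaStar P := lambdaStar_nonneg P
  calc ∑ j ∈ J, specFun hA j x ^ 2 * specVal hA j ^ (2 * t)
      ≤ ∑ j ∈ J, specFun hA j x ^ 2 * lambdaStar P ^ (2 * t) := by
        refine sum_le_sum fun j hj => mul_le_mul_of_nonneg_left ?_ (sq_nonneg _)
        rw [pow_mul, pow_mul, ← sq_abs (specVal hA j)]
        exact pow_le_pow_left₀ (sq_nonneg _)
          (pow_le_pow_left₀ (abs_nonneg _) (abs_specVal_le_lambdaStar hπ hA (mem_filter.mp hj).2) 2) t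
    _ = lambdaStar P ^ (2 * t) * ∑ j ∈ J, specFun hA j x ^ 2 := by rw [mul_sum]; exact sum_congr rfl fun j _ => by ring
    _ ≤ lambdaStar P ^ (2 * t) * (1 / π x) := by
        refine mul_le_mul_of_nonneg_left ?_ (pow_nonneg hl0 _)
        rw [← sum_sq_specFun hπ hA x]
        exact sum_le_sum_of_subset_of_nonneg (filter_subset _ _) fun j _ _ => sq_nonneg _
    _ = lambdaStar P ^ (2 * t) / π x := by ring

/-- `2‖Pᵗ(x,·) − π‖_TV ≤ λ⋆ᵗ/√π(x)` for a reversible irreducible `P` (Lemma 12.18 (i) and the bound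
above). [cite: LevinPeres2017, §12.2 Thm 12.4 (proof); §12.6 Lemma 12.18 (i)] -/
theorem two_mul_tvDist_kernelAt_le (hπ : ∀ x, 0 < π x) (hπ1 : ∑ x, π x = 1)
    (hP : IsRowStochastic P) (hDB : DetailedBalance π P) (hirr : IsIrreducible P) (t : ℕ) (x : X) :
    2 * tvDist (lawAt P (Pi.single x 1) t) π ≤ lambdaStar P ^ t / Real.sqrt (π x) := by
  have hA := symmMatrix_isHermitian hπ hDB
  have hl0 : 0 ≤ lambdaStar P := lambdaStar_nonneg P
  have h1 := (LevinPeres2017_lemma_12_18_i hπ hπ1 hP hDB hirr hA t x).trans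
    (sum_sq_specFun_mul_pow_le hπ hA t x)
  -- `(2‖·‖_TV)² ≤ (λ⋆ᵗ/√π(x))²`
  have hsq : (2 * tvDist (lawAt P (Pi.single x 1) t) π) ^ 2 ≤
      (lambdaStar P ^ t / Real.sqrt (π x)) ^ 2 := by
    rw [div_pow, Real.sq_sqrt (hπ x).le, ← pow_mul, mul_comm t 2]
    linarith [h1]
  have h0 : 0 ≤ lambdaStar P ^ t / Real.sqrt (π x) := div_nonneg (pow_nonneg hl0 t) (Real.sqrt_nonneg _)
  exact (pow_le_pow_iff_left₀ (by linarith [tvDist_nonneg (lawAt P (Pi.single x 1) t) π]) h0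
    two_ne_zero).mp hsq

/-- **`d(t) ≤ e^{−γ⋆t}/(2√π_min)`** for a reversible irreducible `P` with `0 < π_min ≤ π`
("`d(t) ≤ ½√(d^{(∞)}(2t)) ≤ e^{−γ⋆t}/(2√π_min)`"). [cite: LevinPeres2017, §12.2 Thm 12.4 (proof,
last display)] -/
theorem worstTvDist_le_exp_div_two_sqrt (hπ : ∀ x, 0 < π x) (hπ1 : ∑ x, π x = 1)
    (hP : IsRowStochastic P) (hDB : DetailedBalance π P) (hirr : IsIrreducible P) {πmin : ℝ}
    (hmin0 : 0 < πmin) (hmin : ∀ x, πmin ≤ π x) (t : ℕ) :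
    worstTvDist P π t ≤ Real.exp (-(absSpectralGap P * t)) / (2 * Real.sqrt πmin) := by
  have hl0 : 0 ≤ lambdaStar P := lambdaStar_nonneg P
  have hsmin : 0 < Real.sqrt πmin := Real.sqrt_pos.mpr hmin0
  have hpow : lambdaStar P ^ t ≤ Real.exp (-(absSpectralGap P * t)) := by
    unfold absSpectralGap
    calc lambdaStar P ^ t ≤ Real.exp (-(1 - lambdaStar P)) ^ t := by
          refine pow_le_pow_left₀ hl0 ?_ t
          have := Real.one_sub_le_exp_neg (1 - lambdaStar P)
          linarith [this]
      _ = Real.exp (-((1 - lambdaStar P) * t)) := by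
          rw [← Real.exp_nat_mul]; congr 1; ring
  refine Real.iSup_le (fun x => ?_) (div_nonneg (Real.exp_pos _).le (by positivity))
  have h2 := two_mul_tvDist_kernelAt_le hπ hπ1 hP hDB hirr t x
  have hsx : Real.sqrt πmin ≤ Real.sqrt (π x) := Real.sqrt_le_sqrt (hmin x)
  have h3 : lambdaStar P ^ t / Real.sqrt (π x) ≤
      Real.exp (-(absSpectralGap P * t)) / Real.sqrt πmin :=
    (div_le_div_of_nonneg_left (pow_nonneg hl0 t) hsmin hsx).trans
      (div_le_div_of_nonneg_right hpow hsmin.le)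
  have h4 : 2 * tvDist (lawAt P (Pi.single x 1) t) π * Real.sqrt πmin ≤
      Real.exp (-(absSpectralGap P * t)) := by
    have := mul_le_mul_of_nonneg_right (h2.trans h3) hsmin.le
    rwa [div_mul_cancel₀ _ hsmin.ne'] at this
  rw [le_div_iff₀ (by positivity : (0 : ℝ) < 2 * Real.sqrt πmin)]
  linarith [h4]

/-- **THEOREM 12.4 (as printed).**  Let `P` be the transition matrix of a reversible, irreducible
Markov chain (positive stationary `π`, `0 < π_min ≤ π(x)` for all `x`) with `λ⋆ < 1` (`γ⋆ > 0`,
automatic when the chain is also aperiodic, Lemma 12.1).  Then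
**`t_mix(ε) ≤ ⌈t_rel(½ log(1/π_min) + log(1/(2ε)))⌉`** — every `t` at least the real number
inside the ceiling has `d(t) ≤ e^{−γ⋆t}/(2√π_min) ≤ ε`.
[cite: LevinPeres2017, §12.2 Thm 12.4 eq. (12.10) (first inequality)] -/
theorem LevinPeres2017_thm_12_4_sharp (hπ : ∀ x, 0 < π x) (hπ1 : ∑ x, π x = 1)
    (hP : IsRowStochastic P) (hDB : DetailedBalance π P) (hirr : IsIrreducible P)
    (hgap : lambdaStar P < 1) {πmin : ℝ} (hmin0 : 0 < πmin) (hmin : ∀ x, πmin ≤ π x)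
    {ε : ℝ} (hε : 0 < ε) :
    mixingTime P π ε ≤
      ⌈relaxationTime P * (Real.log (1 / πmin) / 2 + Real.log (1 / (2 * ε)))⌉₊ := by
  set T : ℕ := ⌈relaxationTime P * (Real.log (1 / πmin) / 2 + Real.log (1 / (2 * ε)))⌉₊ with hT
  have hγ : 0 < absSpectralGap P := by unfold absSpectralGap; linarith
  have hsmin : 0 < Real.sqrt πmin := Real.sqrt_pos.mpr hmin0
  have hTge : relaxationTime P * (Real.log (1 / πmin) / 2 + Real.log (1 / (2 * ε))) ≤ (T : ℝ) :=
    Nat.le_ceil _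
  -- `e^{−γ⋆ T} ≤ 2ε√π_min`
  have hexp : Real.exp (-(absSpectralGap P * T)) ≤ 2 * ε * Real.sqrt πmin := by
    have h2 : 0 < 2 * ε * Real.sqrt πmin := by positivity
    rw [← Real.exp_log h2]
    apply Real.exp_le_exp.mpr
    have hlog1 : Real.log (1 / πmin) = -Real.log πmin := by rw [one_div, Real.log_inv]
    have hlog2 : Real.log (1 / (2 * ε)) = -Real.log (2 * ε) := by rw [one_div, Real.log_inv]
    have hlog3 : Real.log (2 * ε * Real.sqrt πmin) = Real.log (2 * ε) + Real.log πmin / 2 := by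
      rw [Real.log_mul (by positivity) hsmin.ne', Real.log_sqrt hmin0.le]
    unfold relaxationTime at hTge
    rw [hlog1, hlog2] at hTge
    rw [hlog3]
    have : 1 / absSpectralGap P * (-Real.log πmin / 2 + -Real.log (2 * ε)) * absSpectralGap P ≤
        (T : ℝ) * absSpectralGap P := mul_le_mul_of_nonneg_right hTge hγ.le
    have h3 : 1 / absSpectralGap P * (-Real.log πmin / 2 + -Real.log (2 * ε)) * absSpectralGap P =
        -Real.log πmin / 2 + -Real.log (2 * ε) := by field_simp
    rw [h3] at this
    linarith
  have hd : worstTvDist P π T ≤ ε := by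
    calc worstTvDist P π T ≤ Real.exp (-(absSpectralGap P * T)) / (2 * Real.sqrt πmin) :=
          worstTvDist_le_exp_div_two_sqrt hπ hπ1 hP hDB hirr hmin0 hmin T
      _ ≤ 2 * ε * Real.sqrt πmin / (2 * Real.sqrt πmin) :=
          div_le_div_of_nonneg_right hexp (by positivity)
      _ = ε := by field_simp
  exact mixingTime_le P π hd

end Spectral

end Literature.Probability.MarkovChains
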